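import Summits.HodgeConjecture.HodgeConjecture.Theorems.VHCAbelianSchemesRoadOneNonJumpingPointOfInputs
import Literature.AlgebraicGeometry.Modules.BoxTensorVectorBundle
import HarnessLib

/-!
# Road №4 (`VHCAbelianSchemesRoad`), crux stmt-HodgeConjecture-26512 `DiagLocalOfMarkmanPinnedForall` — route «2T»: the PLUS-SIBLING of the upstairs socket
# «ONE NON-JUMPING TWO-TORSION POINT FOR `q^*E•`» FROM ITS TYPED INPUTS, with `Φ` on the BOUNDED-BELOW derived categories `D⁺`

research route conditional on HC_CM; not a corollary; Q11.4-sentence-2 already refuted in dim ≥ 3.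

Seat core-w5 g7 (claim-free; `--supports stmt-HodgeConjecture-26512 --as helper`; 0 new facts; director-hodge g19 R19.3 (2) ∕ R19.5, LEAD 167 price (a), critic memo-44).
THE SIBLING, NOT A REPLACEMENT: `Theorems/VHCAbelianSchemesRoadOneNonJumpingPointOfInputs.lean` (the socket of record; UNTOUCHED) binds in §5 ∕ §6′ a full, faithful,
shift-commuting functor `Φ : D(Mod_{A×B}) ⥤ D(Mod_P)` on the UNBOUNDED derived categories. The Fourier–Mukai functor the library can construct with 0 facts
(`Literature/AlgebraicGeometry/Modules/DerivedPushforward`: `Rf_*` in the injective model; `AbelianVarieties/FourierMukaiTransformPlus`) lives on `D⁺`, the bounded-below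
derived category `DerivedCategory.Plus` (Mathlib: the full subcategory `t.plus` of `D`, inclusion `DerivedCategory.Plus.ι` — full, faithful, shift-commuting); an unbounded
lift would need K-injective resolutions of unbounded complexes (Spaltenstein), in neither Mathlib nor the tree. This file re-proves the §5 ∕ §6′ statements FROM THE SAME
INPUTS with the ONLY changes: `Φ : DerivedCategory.Plus (A.prod B).X.left.Modules ⥤ DerivedCategory.Plus P.X.left.Modules` (`[Φ.CommShift ℤ] [Φ.Full] [Φ.Faithful]`); the two
box products read as objects of `D⁺` — `⟨Q(Rᵢ• ⊠ Sᵢ•), plus_Q_boxTensorComplex …⟩`, bounded below by the tree's `IsBoundedVBComplex.abelianVarietyBoxTensorComplex` (no new binder);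
and the two isomorphisms stated in the AMBIENT `D(Mod_P)` through `DerivedCategory.Plus.ι`. Same named fact (`KunnethFormulaExt`, the only one), same data binders, same (vi), same
downstairs conclusions. PROOF = §5's with the Hom sets moved three times by the venture's category-agnostic `Summit.Ventures.HSemireg.subsingleton_hom_shift_iff`
(up along `Plus.ι`, across `Φ`, down along `Plus.ι`).

* §1 `plus_Q_boxTensorComplex` — `Q(R• ⊠ S•) ∈ D⁺` for strictly perfect resolutions (bookkeeping); **`not_mem_extJumpLocus_of_fullyFaithful_boxIsos_plus`** (§5's first theorem over `D⁺`).
* §2 **`not_mem_extJumpLocus_quotientPullback_of_twoTorsion_inputs_fullyFaithfulPlus'`** (§6′: `p ∉ J(q^*E•)`, `KunnethFormulaExt` the only named fact) and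
  **`oneNonJumpingPoint_of_inputs_fullyFaithfulPlus'`** (the literal (N-U♭) packaging over `D⁺`).

COSTUME (verbatim R19.5): this is (N-U♭)'s BODY FROM INPUTS over `D⁺` — never (N-U♭) ∕ (N-U); STATUS-only; it becomes a «socket of record» only on the director's word after
the critic's kernel plate. No stub is stated, restated or weakened; nothing touches `closes`, the skeleton or any stub; the unbounded socket stays as it is. NOTHING here says
(N-U♭), (N-U), (S4), the crux, №4, HC_AV, HC_CM or HC holds; HC_CM HELD, by name only; helper lane (width toward the crux = 0).
References: [cite: Markman2025SecantWeil, §9.3 Rem. 9.3.7, Lemma 9.3.5, Lemma 9.3.11; p. 52] [cite: Mukai1981, (3.1) and Thm. 2.2] [cite: StacksProject, Tag 0FXZ]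
[cite: Orlov2002DerivedAbelian, p. 3 L33–40 (transport of Hom sets along fully faithful exact functors)].
-/

noncomputable section

-- `TopCat.Presheaf`/`Scheme.Modules` are not reducible (as in Mathlib's `AlgebraicGeometry/Modules/Sheaf.lean`).
set_option backward.isDefEq.respectTransparency false

open CategoryTheory CategoryTheory.Category CategoryTheory.Limits AlgebraicGeometry

namespace Summit.HodgeConjecture.HodgeConjecture.Ring2.SemiregularRepresentatives

set_option linter.dupNamespace false -- the cell's namespace repeats the summit name, as in every `Ring2*` file

namespace NowhereDisplaceable

open Literature.AlgebraicGeometry Literature.AlgebraicGeometry.Motives Literature.AlgebraicGeometry.Motives.AbelianVariety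
open Literature.AlgebraicGeometry.Modules Literature.AlgebraicGeometry.HodgeTheory Literature.AlgebraicGeometry.KTheory
open Summit.HodgeConjecture.HodgeConjecture.Ring2.SemiregularRepresentatives.MoverTrap

/-! ## §1 Box products of strictly perfect resolutions as objects of `D⁺`, and the Φ-step over `D⁺` -/

/-- **`Q(R• ⊠ S•)` lies in the bounded-below derived category `D⁺(Mod_{A×B})`** for strictly perfect resolutions `R•` (on `A`), `S•` (on `B`): the box product is a bounded
complex of vector bundles (`IsBoundedVBComplex.abelianVarietyBoxTensorComplex`), hence strictly `≥ a` for some `a`, hence cohomologically `≥ a` after `Q`.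
[cite: StacksProject, Tag 012Z (Definition 12.18.3) with Tag 0FXZ] -/
theorem plus_Q_boxTensorComplex (A B : AbelianVariety ℂ) {G : A.X.left.Modules} (R : StrictlyPerfectResolution G) {H : B.X.left.Modules}
    (S : StrictlyPerfectResolution H) :
    letI := HasDerivedCategory.standard (A.prod B).X.left.Modules
    DerivedCategory.TStructure.t.plus (DerivedCategory.Q.obj (A.boxTensorComplex B R.P S.P)) := by
  letI := HasDerivedCategory.standard (A.prod B).X.left.Modules
  obtain ⟨s, hs⟩ := (R.isBoundedVB.abelianVarietyBoxTensorComplex A B S.isBoundedVB).exists_finset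
  obtain ⟨a, ha⟩ := s.bddBelow
  haveI : (A.boxTensorComplex B R.P S.P).IsStrictlyGE a := by
    rw [CochainComplex.isStrictlyGE_iff]
    exact fun i hi => hs i fun his => absurd (ha his) (not_le.mpr hi)
  exact ⟨a, inferInstance⟩

/-- **Steps (iii)–(vi) through a fully faithful `Φ` ON `D⁺`** (sibling of `not_mem_extJumpLocus_of_fullyFaithful_boxIsos`): on `P`, a complex `𝓔` and a point `z`; on `A × B`,
strictly perfect resolutions `Rᵢ•` (on `A`), `Sᵢ•` (of `Hᵢ` on `B`) with `Ext^{≥0}_B(H₁, H₂) = 0`; a full, faithful, shift-commuting `Φ : D⁺(Mod_{A×B}) ⥤ D⁺(Mod_P)` with, in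
`D(Mod_P)`, `ι Φ⟨Q(R₁• ⊠ S₁•)⟩ ≅ Q(τ_z^*•𝓔)` and `ι Φ⟨Q(R₂• ⊠ S₂•)⟩ ≅ Q 𝓔` (`ι = DerivedCategory.Plus.ι`) ⟹ `z ∉ J(𝓔)`. CONDITIONAL on `KunnethFormulaExt`. The Hom sets move
by `Summit.Ventures.HSemireg.subsingleton_hom_shift_iff` along `Plus.ι`, `Φ`, `Plus.ι`. [cite: Mukai1981, Thm. 2.2 and (3.1)] [cite: StacksProject, Tag 0FXZ]
[cite: Markman2025SecantWeil, §9.3 Lemma 9.3.3 and p. 52] [cite: Orlov2002DerivedAbelian, p. 3 L33–40] -/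
theorem not_mem_extJumpLocus_of_fullyFaithful_boxIsos_plus (hK : KunnethFormulaExt) (A B P : AbelianVariety ℂ) (𝓔 : CochainComplex P.X.left.Modules ℤ)
    (z : P.Points ℂ) {G₁ G₂ : A.X.left.Modules} (R₁ : StrictlyPerfectResolution G₁) (R₂ : StrictlyPerfectResolution G₂)
    {H₁ H₂ : B.X.left.Modules} (S₁ : StrictlyPerfectResolution H₁) (S₂ : StrictlyPerfectResolution H₂)
    (hvi : ∀ j : ℕ, letI := HasDerivedCategory.standard B.X.left.Modules
      Subsingleton (ShiftedHom (DerivedCategory.Q.obj ((CochainComplex.singleFunctor B.X.left.Modules 0).obj H₁))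
        (DerivedCategory.Q.obj ((CochainComplex.singleFunctor B.X.left.Modules 0).obj H₂)) (j : ℤ))) :
    letI := HasDerivedCategory.standard (A.prod B).X.left.Modules
    letI := HasDerivedCategory.standard P.X.left.Modules
    ∀ (Φ : DerivedCategory.Plus (A.prod B).X.left.Modules ⥤ DerivedCategory.Plus P.X.left.Modules) [Φ.CommShift ℤ] [Φ.Full] [Φ.Faithful]
      (_ : DerivedCategory.Plus.ι.obj (Φ.obj ⟨DerivedCategory.Q.obj (A.boxTensorComplex B R₁.P S₁.P), plus_Q_boxTensorComplex A B R₁ S₁⟩) ≅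
        DerivedCategory.Q.obj (translationPullbackComplex P z 𝓔))
      (_ : DerivedCategory.Plus.ι.obj (Φ.obj ⟨DerivedCategory.Q.obj (A.boxTensorComplex B R₂.P S₂.P), plus_Q_boxTensorComplex A B R₂ S₂⟩) ≅
        DerivedCategory.Q.obj 𝓔),
      z ∉ extJumpLocus P 𝓔 := by
  letI := HasDerivedCategory.standard (A.prod B).X.left.Modules
  letI := HasDerivedCategory.standard P.X.left.Modules
  intro Φ _ _ _ e₁ e₂
  simp only [extJumpLocus, Set.mem_setOf_eq, not_exists, not_not]
  intro k
  have h := subsingleton_shiftedHom_boxTensor_resolutions_both_of_right A B hK R₁ R₂ S₁ S₂ hvi k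
  -- up into `D⁺(Mod_{A×B})` along the fully faithful, shift-commuting inclusion `Plus.ι`
  have h₁ : Subsingleton
      ((⟨DerivedCategory.Q.obj (A.boxTensorComplex B R₁.P S₁.P), plus_Q_boxTensorComplex A B R₁ S₁⟩ :
          DerivedCategory.Plus (A.prod B).X.left.Modules) ⟶
        (⟨DerivedCategory.Q.obj (A.boxTensorComplex B R₂.P S₂.P), plus_Q_boxTensorComplex A B R₂ S₂⟩ :
          DerivedCategory.Plus (A.prod B).X.left.Modules)⟦k⟧) :=
    (Summit.Ventures.HSemireg.subsingleton_hom_shift_iff DerivedCategory.Plus.ι _ _ k).mp h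
  -- across `Φ`, then back down to `D(Mod_P)` along `Plus.ι`
  have h₂ := (Summit.Ventures.HSemireg.subsingleton_hom_shift_iff Φ _ _ k).mpr h₁
  have h₃ := (Summit.Ventures.HSemireg.subsingleton_hom_shift_iff DerivedCategory.Plus.ι _ _ k).mpr h₂
  exact (e₁.homCongr ((shiftFunctor _ k).mapIso e₂)).subsingleton_congr.mp h₃

/-! ## §2 On `P = J × Ĵ` of a secant–quotient datum, `Φ` on `D⁺`: `p ∉ J(q^*E•)` from the typed inputs, and the literal (N-U♭) packaging -/

/-- **ROUTE 2T, THE GENERAL UPSTAIRS SOCKET OVER `D⁺`, with `KunnethFormulaExt` as the ONLY named fact** (sibling of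
`not_mem_extJumpLocus_quotientPullback_of_twoTorsion_inputs_fullyFaithful'`): DATA — the datum `D`, `E•` on `Y`, the bounded VB complex `𝓔` on `P` with the descent quasi-iso
`f : q^*E• ⟶ (L^{⊗a})^∨ ⊗ 𝓔` (`a` even, `L` rank one), `p ∈ P[2](ℂ)`, resolutions `Rᵢ•`, `Sᵢ•` on `A`, `B`, the functor `Φ : D⁺(Mod_{A×B}) ⥤ D⁺(Mod_P)` (full, faithful,
shift-commuting) with the two isomorphisms in `D(P)` through `Plus.ι`; THE ONE MATHEMATICAL HYPOTHESIS (vi) `Ext^{≥0}_B(H₁, H₂) = 0` ⟹ `p ∉ J(q^*E•)`.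
[cite: Markman2025SecantWeil, §9.3 Rem. 9.3.7 and Lemma 9.3.5; p. 52] [cite: Mukai1981, Thm. 2.2 and (3.1)] [cite: StacksProject, Tag 0FXZ] -/
theorem not_mem_extJumpLocus_quotientPullback_of_twoTorsion_inputs_fullyFaithfulPlus' (hK : KunnethFormulaExt)
    (D : SecantQuotientDatum) (E : CochainComplex D.Y.X.left.Modules ℤ) (𝓔 : CochainComplex D.P.X.left.Modules ℤ) (h𝓔vb : IsBoundedVBComplex 𝓔)
    {L : D.P.X.left.Modules} (hL : HasRank L 1) {a : ℕ} (ha : Even a)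
    (f : haveI := preservesZeroMorphisms_tensorBifunctor_obj (Modules.dual (tensorPow L a))
      quotientPullbackComplex D E ⟶ (((tensorBifunctor D.P.X.left).obj (Modules.dual (tensorPow L a))).mapHomologicalComplex (ComplexShape.up ℤ)).obj 𝓔)
    (hf : haveI := preservesZeroMorphisms_tensorBifunctor_obj (Modules.dual (tensorPow L a)); QuasiIso f)
    {p : D.P.Points ℂ} (hp : p ∈ D.P.torsionPoints ℂ 2) (A B : AbelianVariety ℂ)
    {G₁ G₂ : A.X.left.Modules} (R₁ : StrictlyPerfectResolution G₁) (R₂ : StrictlyPerfectResolution G₂)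
    {H₁ H₂ : B.X.left.Modules} (S₁ : StrictlyPerfectResolution H₁) (S₂ : StrictlyPerfectResolution H₂)
    (hvi : ∀ j : ℕ, letI := HasDerivedCategory.standard B.X.left.Modules
      Subsingleton (ShiftedHom (DerivedCategory.Q.obj ((CochainComplex.singleFunctor B.X.left.Modules 0).obj H₁))
        (DerivedCategory.Q.obj ((CochainComplex.singleFunctor B.X.left.Modules 0).obj H₂)) (j : ℤ))) :
    letI := HasDerivedCategory.standard (A.prod B).X.left.Modules
    letI := HasDerivedCategory.standard D.P.X.left.Modules
    ∀ (Φ : DerivedCategory.Plus (A.prod B).X.left.Modules ⥤ DerivedCategory.Plus D.P.X.left.Modules) [Φ.CommShift ℤ] [Φ.Full] [Φ.Faithful]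
      (_ : DerivedCategory.Plus.ι.obj (Φ.obj ⟨DerivedCategory.Q.obj (A.boxTensorComplex B R₁.P S₁.P), plus_Q_boxTensorComplex A B R₁ S₁⟩) ≅
        DerivedCategory.Q.obj (translationPullbackComplex D.P p 𝓔))
      (_ : DerivedCategory.Plus.ι.obj (Φ.obj ⟨DerivedCategory.Q.obj (A.boxTensorComplex B R₂.P S₂.P), plus_Q_boxTensorComplex A B R₂ S₂⟩) ≅
        DerivedCategory.Q.obj 𝓔),
      p ∉ extJumpLocus D.P (quotientPullbackComplex D E) := by
  intro Φ _ _ _ e₁ e₂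
  exact not_mem_extJumpLocus_quotientPullback_of_quasiIso_dualTensorPow_twist LocallyFreeRankOneIsInvertible_holds D E hL ha hp 𝓔 h𝓔vb f hf
    (not_mem_extJumpLocus_of_fullyFaithful_boxIsos_plus hK A B D.P 𝓔 p R₁ R₂ S₁ S₂ hvi Φ e₁ e₂)

/-- **The literal (N-U♭) packaging over `D⁺`, `KunnethFormulaExt` the ONLY named fact** (sibling of `oneNonJumpingPoint_of_inputs_fullyFaithful'`): from an (O₁)-datum `(γ, 𝓓)`
at `(D, θ₀)` whose carrier `𝓓.E` comes with the DATA above (through `Φ` on `D⁺`), `∃ γ ∈ served, ∃ 𝓓, ∃ p, p ∉ J(q^*𝓓.E)`. [cite: Markman2025SecantWeil, §9.3 Lemma 9.3.11 and Rem. 9.3.7]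
[cite: Mukai1981, Thm. 2.2 and (3.1)] [cite: StacksProject, Tag 0FXZ] -/
theorem oneNonJumpingPoint_of_inputs_fullyFaithfulPlus' (hK : KunnethFormulaExt) (C : ChernCharacterBetti)
    (D : SecantQuotientDatum) (θ₀ : complexBetti D.𝒥.J.X 2) {γ : complexBetti D.Y.X (2 * 3)} (hγ : γ ∈ secantQuotientServedClassesPinned D.Y.X (D.hY θ₀))
    (𝓓 : PinnedTwistedDatum C AdmTw' D.Y.X (D.hY θ₀) γ) (𝓔 : CochainComplex D.P.X.left.Modules ℤ) (h𝓔vb : IsBoundedVBComplex 𝓔)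
    {L : D.P.X.left.Modules} (hL : HasRank L 1) {a : ℕ} (ha : Even a)
    (f : haveI := preservesZeroMorphisms_tensorBifunctor_obj (Modules.dual (tensorPow L a))
      quotientPullbackComplex D 𝓓.E ⟶ (((tensorBifunctor D.P.X.left).obj (Modules.dual (tensorPow L a))).mapHomologicalComplex (ComplexShape.up ℤ)).obj 𝓔)
    (hf : haveI := preservesZeroMorphisms_tensorBifunctor_obj (Modules.dual (tensorPow L a)); QuasiIso f)
    {p : D.P.Points ℂ} (hp : p ∈ D.P.torsionPoints ℂ 2) (A B : AbelianVariety ℂ)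
    {G₁ G₂ : A.X.left.Modules} (R₁ : StrictlyPerfectResolution G₁) (R₂ : StrictlyPerfectResolution G₂)
    {H₁ H₂ : B.X.left.Modules} (S₁ : StrictlyPerfectResolution H₁) (S₂ : StrictlyPerfectResolution H₂)
    (hvi : ∀ j : ℕ, letI := HasDerivedCategory.standard B.X.left.Modules
      Subsingleton (ShiftedHom (DerivedCategory.Q.obj ((CochainComplex.singleFunctor B.X.left.Modules 0).obj H₁))
        (DerivedCategory.Q.obj ((CochainComplex.singleFunctor B.X.left.Modules 0).obj H₂)) (j : ℤ))) :
    letI := HasDerivedCategory.standard (A.prod B).X.left.Modules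
    letI := HasDerivedCategory.standard D.P.X.left.Modules
    ∀ (Φ : DerivedCategory.Plus (A.prod B).X.left.Modules ⥤ DerivedCategory.Plus D.P.X.left.Modules) [Φ.CommShift ℤ] [Φ.Full] [Φ.Faithful]
      (_ : DerivedCategory.Plus.ι.obj (Φ.obj ⟨DerivedCategory.Q.obj (A.boxTensorComplex B R₁.P S₁.P), plus_Q_boxTensorComplex A B R₁ S₁⟩) ≅
        DerivedCategory.Q.obj (translationPullbackComplex D.P p 𝓔))
      (_ : DerivedCategory.Plus.ι.obj (Φ.obj ⟨DerivedCategory.Q.obj (A.boxTensorComplex B R₂.P S₂.P), plus_Q_boxTensorComplex A B R₂ S₂⟩) ≅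
        DerivedCategory.Q.obj 𝓔),
      ∃ γ ∈ secantQuotientServedClassesPinned D.Y.X (D.hY θ₀), ∃ 𝓓 : PinnedTwistedDatum C AdmTw' D.Y.X (D.hY θ₀) γ, ∃ p : D.P.Points ℂ,
        p ∉ extJumpLocus D.P (quotientPullbackComplex D 𝓓.E) := by
  intro Φ _ _ _ e₁ e₂
  exact ⟨γ, hγ, 𝓓, p, not_mem_extJumpLocus_quotientPullback_of_twoTorsion_inputs_fullyFaithfulPlus' hK D 𝓓.E 𝓔 h𝓔vb hL ha f hf hp A B R₁ R₂ S₁ S₂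
    hvi Φ e₁ e₂⟩

end NowhereDisplaceable

end Summit.HodgeConjecture.HodgeConjecture.Ring2.SemiregularRepresentatives

end
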